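import Summits.QuantumAdvantage.QuantumAdvantage.Theses.CubicForrelation
import Literature.Computability.QuantumComplexity.ForrelationDerivativeTables
import Summits.QuantumAdvantage.QuantumAdvantage.Theorems.CubicForrelationNearExactIsExactDerivDegree
import Summits.QuantumAdvantage.QuantumAdvantage.Theorems.CubicForrelationNearExactIsExactRmWeight
import Summits.QuantumAdvantage.QuantumAdvantage.Theorems.CubicForrelationNearExactIsExactMmFormCeilingA
import Summits.QuantumAdvantage.QuantumAdvantage.Theorems.CubicForrelationNearExactIsExactRothaus
import Summits.QuantumAdvantage.QuantumAdvantage.Theorems.CubicForrelationNearExactIsExactFourPointA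

/-!
# Crux `CubicForrelation.NearExactIsExact` (stmt-QuantumAdvantage-14043), line `direct-sum-amplification` —
stub FP: four-point Walsh concentration

**What.** Let `c : 𝔽₂^k → 𝔽₂` have algebraic degree `≤ 3` and write `W(y) = Σ_x (-1)^{c(x) + x·y}` for its
unnormalised Walsh transform (`DerivativeWalsh.W (signOf ∘ c)`). If four DISTINCT characters `y₁, …, y₄` carry more than
`15/16` of the maximal possible absolute Walsh mass of four characters, `|W(y₁)| + … + |W(y₄)| > 15/8 · 2^k`, then the
four characters form a `2`-flat `s + ⟨u, v⟩` (`u, v ≠ 0`, `u ≠ v`) and `c` is the ALIGNED rank-`2` quadratic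
`c(x) = (u·x)(v·x) ⊕ s·x ⊕ e`, in sign form `(-1)^{c(x)} = (-1)^e (-1)^{s·x} (1 + U + V - UV)/2` with `U = (-1)^{u·x}`,
`V = (-1)^{v·x}` (`stub_fourPoint`; consumed by the almost-Maiorana–McFarland ceiling of the line).

**Proof.** (0) Shift: replacing `c` by `c ⊕ ℓ_{y₁}` (`ℓ_y` the linear form with `(-1)^{ℓ_y(x)} = (-1)^{x·y}`,
`fc_linForm_exists`; still cubic, `fc_deg_bxor`) translates `W` by `y₁`, so WLOG the four points are `0, z₂, z₃, z₄`,
distinct and non-zero (`fp_main0` ⇒ `stub_fourPoint`). (1) Rigidity (`fp_rigid`): put `a_i = W(y_i)`, `N = 2^k`,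
`Ψ(x) = Σ_i a_i (-1)^{x·y_i}`. Character orthogonality (`sum_twist_left`) gives `Σ_x (-1)^{c}Ψ = Σ a_i² =: Q` and
`Σ_x Ψ² = NQ`, hence `Σ_x (N(-1)^{c(x)} - Ψ(x))² = N(N² - Q)`; Cauchy–Schwarz and the hypothesis give
`4Q ≥ (Σ|a_i|)² > (15N/8)²`, so this sum is `< N³(1 - 225/256) < N³/8`. Where `c(x)` differs from the rounding
`κ(x) = [Ψ(x) < 0]` the summand is `≥ N²`, so `c ⊕ κ` has weight `< N/8`. But `κ` is a Boolean function of the three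
linear forms `ℓ_{z₂}, ℓ_{z₃}, ℓ_{z₄}`, hence of degree `≤ 3` (`fc_isDegLeFun_comp`, `bb_isDegLeFun_card`), so the
degree-`≤ 3` function `c ⊕ κ` of weight `< 2^{k-3}` vanishes by the Reed–Muller minimum distance (`stub_rmWeight` fed
with `stub_derivDegree`): `c = F(ℓ_{z₂}, ℓ_{z₃}, ℓ_{z₄})` for a Boolean `F` on `3` bits. (2) By `fp_sum_cube` the four
values `8W(y_i)/N` are (sums of two) integer Walsh–Hadamard sums of `F` on the cube, and the two finite checks of part A
conclude: if `z₂, z₃, z₄` are independent, `Σ_i |W(y_i)| ≤ 12N/8 < 15N/8` (`fp_checkA`) — contradiction; if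
`z₄ = z₂ ⊕ z₃`, `F(p,q,p ⊕ q) = pq ⊕ αp ⊕ βq ⊕ e` (`fp_checkB`), which is the claimed normal form with `u = z₂`, `v = z₃`,
`s = αz₂ ⊕ βz₃` (`fp_sign_formula`, `fp_flat`).

References (orientation; everything here is proved): C. Carlet, *Boolean Functions for Cryptography and Coding
Theory* (CUP 2020), §2.3 (Walsh transform, Parseval) and §4.1 Thm 7 (minimum distance `2^{m-d}` of `RM(d,m)`);
F. J. MacWilliams, N. J. A. Sloane, *The Theory of Error-Correcting Codes* (1977), Ch. 13–14; R. O'Donnell,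
*Analysis of Boolean Functions* (CUP 2014), §1.4 (orthogonality of characters; rounding a real function to a Boolean one).
-/

set_option linter.dupNamespace false -- D-0017: single-problem summit ⇒ `QuantumAdvantage.QuantumAdvantage` by design

noncomputable section

namespace Summit.QuantumAdvantage.QuantumAdvantage.Theorems.CubicForrelation.NearExactIsExact

open Finset
open Literature.Computability.QuantumComplexity
open Literature.Computability.QuantumComplexity.BuzetChailloux (bxor zeroVec signOf_sq bxor_zeroVec zeroVec_bxor
  bxor_self bxor_bxor_cancel_left bxor_eq_zeroVec_iff twist_bxor_right twist_zeroVec_right sum_twist_left)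
open Literature.Computability.QuantumComplexity.DerivativeWalsh (W)

/-! ### Rigidity: near-concentration on four characters forces a function of three linear forms -/

/-- **Rigidity step.** If a cubic `c` on `k` bits carries Walsh mass `> 15/8 · 2^k` on `0, z₂, z₃, z₄` (distinct,
non-zero), then `c = F(ℓ₂, ℓ₃, ℓ₄)` for some Boolean `F` on `3` bits, where the `ℓ_i` are linear forms with
`(-1)^{ℓ_i(x)} = (-1)^{x·z_i}`: the rounding `κ = [Ψ < 0]` of the projection `Ψ = Σ_i W(y_i) (-1)^{x·y_i}` is such a
composite, has degree `≤ 3`, and differs from `c` on `< 2^k/8` points (orthogonality + Cauchy–Schwarz), so `c ⊕ κ = 0`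
by the Reed–Muller minimum distance `2^{k-3}` (`stub_rmWeight` + `stub_derivDegree`). [cite: Carlet2020, §4.1 Thm 7] -/
theorem fp_rigid {k : ℕ} (c : (Fin k → Bool) → Bool) {z₂ z₃ z₄ : Fin k → Bool}
    {l₂ l₃ l₄ : (Fin k → Bool) → Bool}
    (hl₂ : ∀ x, signOf (l₂ x) = twist x z₂) (hl₃ : ∀ x, signOf (l₃ x) = twist x z₃)
    (hl₄ : ∀ x, signOf (l₄ x) = twist x z₄)
    (hd₂ : IsDegLeFun 1 l₂) (hd₃ : IsDegLeFun 1 l₃) (hd₄ : IsDegLeFun 1 l₄) (hc : IsDegLeFun 3 c)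
    (h₂ : z₂ ≠ zeroVec) (h₃ : z₃ ≠ zeroVec) (h₄ : z₄ ≠ zeroVec) (h₂₃ : z₂ ≠ z₃) (h₂₄ : z₂ ≠ z₄)
    (h₃₄ : z₃ ≠ z₄)
    (hmass : (15 / 8 : ℝ) * (2 : ℝ) ^ k < |W (fun x => signOf (c x)) zeroVec| +
      |W (fun x => signOf (c x)) z₂| + |W (fun x => signOf (c x)) z₃| + |W (fun x => signOf (c x)) z₄|) :
    ∃ F : Bool → Bool → Bool → Bool, ∀ x, c x = F (l₂ x) (l₃ x) (l₄ x) := by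
  set g : (Fin k → Bool) → ℝ := fun x => signOf (c x) with hg
  set a₁ : ℝ := W g zeroVec with ha₁
  set a₂ : ℝ := W g z₂ with ha₂
  set a₃ : ℝ := W g z₃ with ha₃
  set a₄ : ℝ := W g z₄ with ha₄
  have h2k : (0 : ℝ) < (2 : ℝ) ^ k := by positivity
  -- the projection `Ψ` onto the four characters and its rounding `F(ℓ₂, ℓ₃, ℓ₄)`
  obtain ⟨Ψ, hΨ⟩ : ∃ Ψ : (Fin k → Bool) → ℝ,
      ∀ x, Ψ x = a₁ + a₂ * twist x z₂ + a₃ * twist x z₃ + a₄ * twist x z₄ := ⟨_, fun _ => rfl⟩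
  obtain ⟨F, hF⟩ : ∃ F : Bool → Bool → Bool → Bool,
      ∀ p q r, F p q r = decide (a₁ + a₂ * signOf p + a₃ * signOf q + a₄ * signOf r < 0) :=
    ⟨_, fun _ _ _ => rfl⟩
  refine ⟨F, ?_⟩
  have hκ : ∀ x, F (l₂ x) (l₃ x) (l₄ x) = decide (Ψ x < 0) := by
    intro x
    rw [hF, hl₂, hl₃, hl₄, hΨ]
  -- the rounding is a function of three linear forms, hence of degree `≤ 3`
  have hκdeg : IsDegLeFun 3 (fun x => F (l₂ x) (l₃ x) (l₄ x)) := by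
    have hF' : IsDegLeFun 3 (fun b : Fin 3 → Bool => F (b 0) (b 1) (b 2)) := bb_isDegLeFun_card _
    have hσ : ∀ v : Fin 3, IsDegLeFun 1 (fun x => (![l₂ x, l₃ x, l₄ x] : Fin 3 → Bool) v) := by
      intro v
      fin_cases v
      · simpa using hd₂
      · simpa using hd₃
      · simpa using hd₄
    have h := fc_isDegLeFun_comp hF' (fun x => (![l₂ x, l₃ x, l₄ x] : Fin 3 → Bool)) hσ (le_refl (1 * 3))
    exact rm_isDegLeFun_congr h fun x => by simp
  -- (ii) `Σ_x (-1)^{c(x)} Ψ(x) = Q`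
  have hgΨ : ∑ x, g x * Ψ x = a₁ ^ 2 + a₂ ^ 2 + a₃ ^ 2 + a₄ ^ 2 := by
    have e : ∀ x, g x * Ψ x = a₁ * (g x * twist x zeroVec) + a₂ * (g x * twist x z₂) +
        a₃ * (g x * twist x z₃) + a₄ * (g x * twist x z₄) := by
      intro x
      rw [hΨ, twist_zeroVec_right]
      ring
    simp only [e, sum_add_distrib, ← mul_sum]
    show a₁ * a₁ + a₂ * a₂ + a₃ * a₃ + a₄ * a₄ = _
    ring
  -- (iii) `Σ_x Ψ(x)² = 2^k Q`
  have hΨ2 : ∑ x, Ψ x ^ 2 = (2 : ℝ) ^ k * (a₁ ^ 2 + a₂ ^ 2 + a₃ ^ 2 + a₄ ^ 2) := by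
    have e : ∀ x, Ψ x ^ 2 = (a₁ ^ 2 + a₂ ^ 2 + a₃ ^ 2 + a₄ ^ 2) + 2 * a₁ * a₂ * twist x z₂ +
        2 * a₁ * a₃ * twist x z₃ + 2 * a₁ * a₄ * twist x z₄ + 2 * a₂ * a₃ * twist x (bxor z₂ z₃) +
        2 * a₂ * a₄ * twist x (bxor z₂ z₄) + 2 * a₃ * a₄ * twist x (bxor z₃ z₄) := by
      intro x
      rw [hΨ, twist_bxor_right, twist_bxor_right, twist_bxor_right]
      linear_combination (a₂ ^ 2) * Simon.twist_sq x z₂ + (a₃ ^ 2) * Simon.twist_sq x z₃ +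
        (a₄ ^ 2) * Simon.twist_sq x z₄
    have e₂₃ : bxor z₂ z₃ ≠ zeroVec := fun h => h₂₃ ((bxor_eq_zeroVec_iff _ _).1 h)
    have e₂₄ : bxor z₂ z₄ ≠ zeroVec := fun h => h₂₄ ((bxor_eq_zeroVec_iff _ _).1 h)
    have e₃₄ : bxor z₃ z₄ ≠ zeroVec := fun h => h₃₄ ((bxor_eq_zeroVec_iff _ _).1 h)
    simp only [e, sum_add_distrib, ← mul_sum, sum_const, card_univ, fp_card_nsmul, sum_twist_left]
    rw [if_neg h₂, if_neg h₃, if_neg h₄, if_neg e₂₃, if_neg e₂₄, if_neg e₃₄]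
    ring
  -- (iv) `Σ_x (2^k (-1)^{c(x)} - Ψ(x))² = 2^k (4^k - Q)`
  have hD : ∑ x, ((2 : ℝ) ^ k * g x - Ψ x) ^ 2 =
      (2 : ℝ) ^ k * (((2 : ℝ) ^ k) ^ 2 - (a₁ ^ 2 + a₂ ^ 2 + a₃ ^ 2 + a₄ ^ 2)) := by
    have e : ∀ x, ((2 : ℝ) ^ k * g x - Ψ x) ^ 2 =
        ((2 : ℝ) ^ k) ^ 2 - 2 * (2 : ℝ) ^ k * (g x * Ψ x) + Ψ x ^ 2 := by
      intro x
      have hg2 : g x ^ 2 = 1 := signOf_sq (c x)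
      linear_combination ((2 : ℝ) ^ k) ^ 2 * hg2
    simp only [e, sum_add_distrib, sum_sub_distrib, ← mul_sum, hgΨ, hΨ2, sum_const, card_univ, fp_card_nsmul]
    ring
  -- (v) Cauchy–Schwarz: `(15 · 2^k / 8)² < (Σ|a_i|)² ≤ 4Q`
  have hQ : ((15 / 8 : ℝ) * (2 : ℝ) ^ k) ^ 2 < 4 * (a₁ ^ 2 + a₂ ^ 2 + a₃ ^ 2 + a₄ ^ 2) := by
    have h0 : (0 : ℝ) ≤ (15 / 8 : ℝ) * (2 : ℝ) ^ k := by positivity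
    have hS : ((15 / 8 : ℝ) * (2 : ℝ) ^ k) ^ 2 < (|a₁| + |a₂| + |a₃| + |a₄|) ^ 2 := by
      rw [sq, sq]
      exact mul_self_lt_mul_self h0 hmass
    have hCS : (|a₁| + |a₂| + |a₃| + |a₄|) ^ 2 ≤ 4 * (a₁ ^ 2 + a₂ ^ 2 + a₃ ^ 2 + a₄ ^ 2) := by
      rw [← sq_abs a₁, ← sq_abs a₂, ← sq_abs a₃, ← sq_abs a₄]
      nlinarith [sq_nonneg (|a₁| - |a₂|), sq_nonneg (|a₁| - |a₃|), sq_nonneg (|a₁| - |a₄|),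
        sq_nonneg (|a₂| - |a₃|), sq_nonneg (|a₂| - |a₄|), sq_nonneg (|a₃| - |a₄|)]
    exact hS.trans_le hCS
  -- (vi) where `c` differs from the rounding, the summand of (iv) is `≥ 4^k`
  have hbad : ∀ x, (c x ^^ F (l₂ x) (l₃ x) (l₄ x)) = true →
      ((2 : ℝ) ^ k) ^ 2 ≤ ((2 : ℝ) ^ k * g x - Ψ x) ^ 2 := by
    intro x hx
    rw [hκ x] at hx
    by_cases hΨx : Ψ x < 0
    · rw [decide_eq_true hΨx] at hx
      have hcx : c x = false := by revert hx; cases c x <;> simp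
      have hgx : g x = 1 := by simp [hg, hcx, signOf]
      rw [hgx, mul_one]
      exact pow_le_pow_left₀ h2k.le (by linarith) 2
    · rw [decide_eq_false hΨx] at hx
      have hcx : c x = true := by revert hx; cases c x <;> simp
      have hgx : g x = -1 := by simp [hg, hcx, signOf]
      rw [hgx, show ((2 : ℝ) ^ k * -1 - Ψ x) ^ 2 = ((2 : ℝ) ^ k + Ψ x) ^ 2 by ring]
      push Not at hΨx
      exact pow_le_pow_left₀ h2k.le (by linarith) 2
  -- (vii) hence `4^k · #{c ≠ κ} ≤ 2^k (4^k - Q)` and `8 · #{c ≠ κ} < 2^k`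
  have hcard : ((2 : ℝ) ^ k) ^ 2 * ((univ.filter fun x => (c x ^^ F (l₂ x) (l₃ x) (l₄ x)) = true).card : ℝ) ≤
      (2 : ℝ) ^ k * (((2 : ℝ) ^ k) ^ 2 - (a₁ ^ 2 + a₂ ^ 2 + a₃ ^ 2 + a₄ ^ 2)) := by
    rw [← hD]
    have e : ((2 : ℝ) ^ k) ^ 2 * ((univ.filter fun x => (c x ^^ F (l₂ x) (l₃ x) (l₄ x)) = true).card : ℝ) =
        ∑ x, (if (c x ^^ F (l₂ x) (l₃ x) (l₄ x)) = true then ((2 : ℝ) ^ k) ^ 2 else 0) := by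
      rw [sum_ite, sum_const_zero, add_zero, sum_const, nsmul_eq_mul, mul_comm]
    rw [e]
    refine sum_le_sum fun x _ => ?_
    split_ifs with hx
    · exact hbad x hx
    · exact sq_nonneg _
  have hcount : 8 * (univ.filter fun x => (c x ^^ F (l₂ x) (l₃ x) (l₄ x)) = true).card < 2 ^ k := by
    set B : ℕ := (univ.filter fun x => (c x ^^ F (l₂ x) (l₃ x) (l₄ x)) = true).card with hB
    have hBlt : (B : ℝ) < (2 : ℝ) ^ k / 8 := by
      by_contra hcon
      push Not at hcon
      have h1 : ((2 : ℝ) ^ k) ^ 2 * ((2 : ℝ) ^ k / 8) ≤ ((2 : ℝ) ^ k) ^ 2 * (B : ℝ) :=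
        mul_le_mul_of_nonneg_left hcon (by positivity)
      have h3 : (2 : ℝ) ^ k * (((15 / 8 : ℝ) * (2 : ℝ) ^ k) ^ 2) <
          (2 : ℝ) ^ k * (4 * (a₁ ^ 2 + a₂ ^ 2 + a₃ ^ 2 + a₄ ^ 2)) := mul_lt_mul_of_pos_left hQ h2k
      have hp3 : (0 : ℝ) < ((2 : ℝ) ^ k) ^ 3 := by positivity
      nlinarith [h1, hcard, h3, hp3]
    have : ((8 * B : ℕ) : ℝ) < ((2 ^ k : ℕ) : ℝ) := by push_cast; linarith
    exact_mod_cast this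
  -- (viii) Reed–Muller: a degree-`≤ 3` function of weight `< 2^{k-3}` vanishes
  intro x
  by_contra hne
  have hex : ∃ x, (c x ^^ F (l₂ x) (l₃ x) (l₄ x)) = true := ⟨x, rm_xor_eq_true_of_ne _ _ hne⟩
  have hR := stub_rmWeight stub_derivDegree k 3 (fun x => c x ^^ F (l₂ x) (l₃ x) (l₄ x))
    (fc_deg_bxor hc hκdeg) hex
  beta_reduce at hR
  rw [show (2 : ℕ) ^ 3 = 8 from rfl] at hR
  omega

/-! ### The four-point lemma based at `0` -/

/-- **Four-point lemma, based at `0`.** For cubic `c` on `k` bits and distinct non-zero `z₂, z₃, z₄` with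
`|W(0)| + |W(z₂)| + |W(z₃)| + |W(z₄)| > 15/8 · 2^k`: `z₄ = z₂ ⊕ z₃` and `c` is the aligned rank-`2` quadratic on the
flat `{0, z₂, z₃, z₂ ⊕ z₃}`. [folklore] -/
theorem fp_main0 {k : ℕ} (c : (Fin k → Bool) → Bool) (z₂ z₃ z₄ : Fin k → Bool) (hc : IsDegLeFun 3 c)
    (h₂ : z₂ ≠ zeroVec) (h₃ : z₃ ≠ zeroVec) (h₄ : z₄ ≠ zeroVec) (h₂₃ : z₂ ≠ z₃) (h₂₄ : z₂ ≠ z₄)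
    (h₃₄ : z₃ ≠ z₄)
    (hmass : (15 / 8 : ℝ) * (2 : ℝ) ^ k < |W (fun x => signOf (c x)) zeroVec| +
      |W (fun x => signOf (c x)) z₂| + |W (fun x => signOf (c x)) z₃| + |W (fun x => signOf (c x)) z₄|) :
    ∃ (s u v : Fin k → Bool) (e : Bool), u ≠ zeroVec ∧ v ≠ zeroVec ∧ u ≠ v ∧
      (∀ x, signOf (c x) = signOf e * twist s x * ((1 + twist u x + twist v x - twist u x * twist v x) / 2)) ∧
      ({zeroVec, z₂, z₃, z₄} : Finset (Fin k → Bool)) = {s, bxor s u, bxor s v, bxor s (bxor u v)} := by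
  obtain ⟨l, hldeg, hlsign⟩ := fc_linForm_exists k
  -- (1) rigidity: `c = F(ℓ_{z₂}, ℓ_{z₃}, ℓ_{z₄})`
  obtain ⟨F, hcF⟩ := fp_rigid c (hlsign z₂) (hlsign z₃) (hlsign z₄) (hldeg z₂) (hldeg z₃) (hldeg z₄) hc
    h₂ h₃ h₄ h₂₃ h₂₄ h₃₄ hmass
  -- (2) the four Walsh values through the cube sums of `F`
  have hWi : ∀ (H : Bool → Bool → Bool → ℝ) (y : Fin k → Bool),
      (∀ x, signOf (c x) * twist x y = H (l z₂ x) (l z₃ x) (l z₄ x)) →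
      8 * W (fun x => signOf (c x)) y = (2 : ℝ) ^ k * ((∑ p, ∑ q, ∑ r, H p q r) +
        if bxor z₂ z₃ = z₄ then ∑ p, ∑ q, ∑ r, H p q r * (signOf p * (signOf q * signOf r)) else 0) := by
    intro H y hy
    have e : W (fun x => signOf (c x)) y = ∑ x, H (l z₂ x) (l z₃ x) (l z₄ x) := by
      simp only [W]
      exact sum_congr rfl fun x _ => hy x
    rw [e]
    exact fp_sum_cube (hlsign z₂) (hlsign z₃) (hlsign z₄) h₂ h₃ h₄ h₂₃ h₂₄ h₃₄ H
  have hW0 := hWi (fun p q r => signOf (F p q r)) zeroVec fun x => by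
    rw [twist_zeroVec_right, mul_one, hcF x]
  have hW2 := hWi (fun p q r => signOf (F p q r) * signOf p) z₂ fun x => by rw [← hlsign z₂ x, hcF x]
  have hW3 := hWi (fun p q r => signOf (F p q r) * signOf q) z₃ fun x => by rw [← hlsign z₃ x, hcF x]
  have hW4 := hWi (fun p q r => signOf (F p q r) * signOf r) z₄ fun x => by rw [← hlsign z₄ x, hcF x]
  beta_reduce at hW0 hW2 hW3 hW4
  by_cases hdep : bxor z₂ z₃ = z₄
  · -- (3B) `z₄ = z₂ ⊕ z₃`: the restriction of `F` to the plane is bent ⇒ aligned rank-2 quadratic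
    rw [if_pos hdep] at hW0 hW2 hW3 hW4
    rw [fp_abs_eq k hW0, fp_abs_eq k hW2, fp_abs_eq k hW3, fp_abs_eq k hW4] at hmass
    obtain ⟨α, β, e, hαβ⟩ := fp_checkB F (by
      by_contra hcon
      push Not at hcon
      have := mul_le_mul_of_nonneg_left hcon (by positivity : (0 : ℝ) ≤ (2 : ℝ) ^ k / 8)
      linarith)
    subst hdep
    have hl₄ : ∀ x, l (bxor z₂ z₃) x = (l z₂ x ^^ l z₃ x) := fun x =>
      fp_signOf_inj _ _ (by rw [signOf_xor, hlsign, hlsign, hlsign, twist_bxor_right])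
    have hcx : ∀ x, c x = ((l z₂ x && l z₃ x) ^^ ((α && l z₂ x) ^^ ((β && l z₃ x) ^^ e))) := fun x => by
      rw [hcF x, hl₄ x, hαβ]
    refine ⟨bxor (if α then z₂ else zeroVec) (if β then z₃ else zeroVec), z₂, z₃, e, h₂, h₃, h₂₃,
      fun x => ?_, fp_flat z₂ z₃ α β⟩
    rw [hcx x]
    exact fp_sign_formula (hlsign z₂ x) (hlsign z₃ x) α β e
  · -- (3A) `z₂, z₃, z₄` independent: the four cube sums have total modulus `≤ 12 < 15`
    exfalso
    rw [if_neg hdep, add_zero] at hW0 hW2 hW3 hW4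
    rw [fp_abs_eq k hW0, fp_abs_eq k hW2, fp_abs_eq k hW3, fp_abs_eq k hW4] at hmass
    have hA := mul_le_mul_of_nonneg_left (fp_checkA F) (by positivity : (0 : ℝ) ≤ (2 : ℝ) ^ k / 8)
    have h2k : (0 : ℝ) < (2 : ℝ) ^ k := by positivity
    linarith

/-! ### The stub -/

/-- **stub_fourPoint** (FP; four-point Walsh concentration). If a function `c` of degree `≤ 3` on `k` bits puts more
than `15/8 · 2^k` of absolute (unnormalised) Walsh mass on four distinct characters `y₁..y₄`, then the four characters
form a `2`-flat `s + ⟨u, v⟩` and `c` is the ALIGNED rank-`2` quadratic `(u·x)(v·x) ⊕ s·x ⊕ e`, i.e.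
`(-1)^{c} = (-1)^e (-1)^{s·x} (1 + U + V - UV)/2` with `U = (-1)^{u·x}`, `V = (-1)^{v·x}`. Reduced to the based case
`fp_main0` by the shift `c ↦ c ⊕ ℓ_{y₁}`, which translates the Walsh transform by `y₁`. [folklore] -/
theorem stub_fourPoint :
    ∀ (k : ℕ) (c : (Fin k → Bool) → Bool) (y₁ y₂ y₃ y₄ : Fin k → Bool), IsDegLeFun 3 c →
      y₁ ≠ y₂ → y₁ ≠ y₃ → y₁ ≠ y₄ → y₂ ≠ y₃ → y₂ ≠ y₄ → y₃ ≠ y₄ →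
      (15 / 8 : ℝ) * (2 : ℝ) ^ k < |W (fun x => signOf (c x)) y₁| + |W (fun x => signOf (c x)) y₂| +
        |W (fun x => signOf (c x)) y₃| + |W (fun x => signOf (c x)) y₄| →
      ∃ (s u v : Fin k → Bool) (e : Bool), u ≠ zeroVec ∧ v ≠ zeroVec ∧ u ≠ v ∧
        (∀ x, signOf (c x) = signOf e * twist s x * ((1 + twist u x + twist v x - twist u x * twist v x) / 2)) ∧
        ({y₁, y₂, y₃, y₄} : Finset (Fin k → Bool)) = {s, bxor s u, bxor s v, bxor s (bxor u v)} := by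
  intro k c y₁ y₂ y₃ y₄ hc h12 h13 h14 h23 h24 h34 hmass
  obtain ⟨l, hldeg, hlsign⟩ := fc_linForm_exists k
  -- the shifted function `c' = c ⊕ ℓ_{y₁}`
  set c' : (Fin k → Bool) → Bool := fun x => c x ^^ l y₁ x with hc'
  have hc'deg : IsDegLeFun 3 c' := fc_deg_bxor hc ((hldeg y₁).mono (by norm_num))
  have hsign' : ∀ x, signOf (c' x) = signOf (c x) * twist x y₁ := fun x => by
    simp only [hc', signOf_xor, hlsign]
  have hW' : ∀ y, W (fun x => signOf (c' x)) y = W (fun x => signOf (c x)) (bxor y₁ y) := by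
    intro y
    simp only [W]
    refine sum_congr rfl fun x _ => ?_
    rw [hsign', twist_bxor_right]
    ring
  have hmass' : (15 / 8 : ℝ) * (2 : ℝ) ^ k < |W (fun x => signOf (c' x)) zeroVec| +
      |W (fun x => signOf (c' x)) (bxor y₁ y₂)| + |W (fun x => signOf (c' x)) (bxor y₁ y₃)| +
      |W (fun x => signOf (c' x)) (bxor y₁ y₄)| := by
    rw [hW', hW', hW', hW', bxor_zeroVec, bxor_bxor_cancel_left, bxor_bxor_cancel_left, bxor_bxor_cancel_left]
    exact hmass
  have hne0 : ∀ {a : Fin k → Bool}, y₁ ≠ a → bxor y₁ a ≠ zeroVec := fun h e =>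
    h ((bxor_eq_zeroVec_iff _ _).1 e)
  have hne : ∀ {a b : Fin k → Bool}, a ≠ b → bxor y₁ a ≠ bxor y₁ b := fun h e =>
    h (by simpa using congrArg (bxor y₁) e)
  obtain ⟨s, u, v, e, hu, hv, huv, hsgn, hflat⟩ := fp_main0 c' (bxor y₁ y₂) (bxor y₁ y₃) (bxor y₁ y₄) hc'deg
    (hne0 h12) (hne0 h13) (hne0 h14) (hne h23) (hne h24) (hne h34) hmass'
  refine ⟨bxor y₁ s, u, v, e, hu, hv, huv, fun x => ?_, ?_⟩
  · -- undo the shift in the sign formula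
    have h1 : signOf (c x) = signOf (c' x) * twist x y₁ := by
      rw [hsign', mul_assoc, Simon.twist_mul_self, mul_one]
    rw [h1, hsgn x, twist_comm (bxor y₁ s) x, twist_bxor_right, twist_comm x s]
    ring
  · -- undo the shift in the flat
    have himg : ({y₁, y₂, y₃, y₄} : Finset (Fin k → Bool)) =
        ({zeroVec, bxor y₁ y₂, bxor y₁ y₃, bxor y₁ y₄} : Finset (Fin k → Bool)).image (bxor y₁) := by
      simp only [image_insert, image_singleton, bxor_zeroVec, bxor_bxor_cancel_left]
    rw [himg, hflat]
    simp only [image_insert, image_singleton, ExactPairsMaioranaMcFarland.dv_bxor_assoc]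

end Summit.QuantumAdvantage.QuantumAdvantage.Theorems.CubicForrelation.NearExactIsExact
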